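import Literature.Computability.QuantumComplexity.WordCircuit
import Literature.Computability.QuantumComplexity.BlockKit
import HarnessLib

/-!
# The geometry of one Hadamard-test copy inside its block

Topic `Literature/Computability/QuantumComplexity`; a step in the discharge of
`ajl_jonesApproxProblem_mem_PromiseBQP`. On the block of `BlockKit.lean` (`bsize n r k` wires) we
place the test qubit (wire `0`), the path register (wires `1 …`), the table (after it) and the kit,
obtaining a `WordGeom (bsize n r k) n r` (`geom`), and prove it well formed (`geom_ok`, `k ≥ 1`).

## References

* D. Aharonov, V. Jones, Z. Landau, Algorithmica 55 (2009), §3.3 [AharonovJonesLandau2009].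
-/

namespace Literature.Computability.QuantumComplexity

open Cryptography RevSim BlockKit

namespace BlockGeom

variable (n r k : ℕ)

/-- The index of a letter in the table of a slot: `2 i + σ`. [folklore] -/
def idx {n : ℕ} (p : Fin (n - 1) × Bool) : ℕ := 2 * (p.1 : ℕ) + p.2.toNat

/-- Letter indices are below the number of letters. [folklore] -/
theorem idx_lt {n : ℕ} (p : Fin (n - 1) × Bool) : idx p < A n := by
  unfold idx A; have := p.1.2; cases p.2 <;> simp; omega

/-- The table wire of slot `s`, letter `p` (as a number). [folklore] -/
def twNat {n : ℕ} (s : ℕ) (p : Fin (n - 1) × Bool) : ℕ := 1 + 2 * (n + 1) + s * A n + idx p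

/-- Table wires are below the dummy wire. [folklore] -/
theorem twNat_lt {n r : ℕ} {s : ℕ} (hs : s < r) (p : Fin (n - 1) × Bool) : twNat s p < dataOff n r := by
  unfold twNat dataOff
  have h1 := idx_lt p
  have h2 : s * A n + A n ≤ r * A n := by rw [← Nat.succ_mul]; exact Nat.mul_le_mul_right _ hs
  omega

/-- The path-register embedding `i ↦ 1 + i`. [folklore] -/
noncomputable def pathEmb : Fin (2 * (n + 1)) ↪ Fin (bsize n r k) :=
  ⟨fun i => wire n r k (1 + i), fun i i' h => by
    have hb : ∀ j : Fin (2 * (n + 1)), 1 + (j : ℕ) < bsize n r k := fun j => by have := j.2; unfold bsize rb dataOff; omega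
    exact Fin.ext (by have := wire_inj n r k (hb i) (hb i') h; omega)⟩

/-- **The geometry of a copy in its block.** [folklore] -/
noncomputable def geom : WordGeom (bsize n r k) n r where
  kit := kit n r k
  E := pathEmb n r k
  q := wire n r k 0
  tw s p := wire n r k (twNat s p)

variable {n r k}

/-- Sizes, for `omega`. [folklore] -/
theorem sizes : dataOff n r = 1 + 2 * (n + 1) + r * A n ∧ rb n r k = dataOff n r + 2 + k + (k + regionSize k) ∧ bsize n r k = rb n r k + regionSize k :=
  ⟨rfl, rfl, rfl⟩

/-- Values of the local wires of generator `i`. [folklore] -/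
theorem eOf_val (i : Fin (n - 1)) (j : Fin 6) : ((geom n r k).eOf i j : ℕ) = 1 + (2 * (i : ℕ) + j) := by
  show ((wire n r k (1 + ((tripleEmb i j : Fin (2 * (n + 1))) : ℕ)) : Fin _) : ℕ) = _
  have := (tripleEmb i j).2
  rw [wire_val n r k (by obtain ⟨h1, h2, h3⟩ := @sizes n r k; omega), tripleEmb_val]

/-- Local wires are below the table. [folklore] -/
theorem eOf_val_lt (i : Fin (n - 1)) (j : Fin 6) : ((geom n r k).eOf i j : ℕ) < 1 + 2 * (n + 1) := by
  rw [eOf_val]; have := i.2; have := j.2; omega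

/-- Value of the test qubit. [folklore] -/
theorem q_val : ((geom n r k).q : ℕ) = 0 := wire_val n r k (bsize_pos n r k)

/-- Values of the table wires. [folklore] -/
theorem tw_val (s : Fin r) (p : Fin (n - 1) × Bool) : ((geom n r k).tw s p : ℕ) = twNat (s : ℕ) p := by
  show ((wire n r k (twNat (s : ℕ) p) : Fin _) : ℕ) = _
  have := twNat_lt s.2 p (n := n)
  rw [wire_val n r k (by obtain ⟨h1, h2, h3⟩ := @sizes n r k; omega)]

/-- Values of the path wires. [folklore] -/
theorem E_val (i : Fin (2 * (n + 1))) : ((geom n r k).E i : ℕ) = 1 + i := by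
  show ((wire n r k (1 + (i : ℕ)) : Fin _) : ℕ) = _
  have := i.2
  rw [wire_val n r k (by obtain ⟨h1, h2, h3⟩ := @sizes n r k; omega)]

/-- Values of the Hadamard wires: in `[dataOff + 1, dataOff + 2 + k)`. [folklore] -/
theorem had_val {a : Fin (bsize n r k)} (ha : a ∈ (geom n r k).kit.cr :: (geom n r k).kit.as) : dataOff n r + 1 ≤ (a : ℕ) ∧ (a : ℕ) < dataOff n r + 2 + k := by
  change a ∈ (kit n r k).cr :: (kit n r k).as at ha
  rw [kit_cr, kit_as, List.mem_cons, List.mem_map] at ha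
  obtain ⟨h1, h2, h3⟩ := @sizes n r k
  rcases ha with rfl | ⟨j, hj, rfl⟩
  · rw [wire_val n r k (by omega)]; omega
  · rw [List.mem_range] at hj; rw [wire_val n r k (by omega)]; omega

/-- Values of the helper wires: in `[dataOff + 2 + k, rb)`. [folklore] -/
theorem hs_val {a : Fin (bsize n r k)} (ha : a ∈ (geom n r k).kit.hs) : dataOff n r + 2 + k ≤ (a : ℕ) ∧ (a : ℕ) < rb n r k := by
  change a ∈ (kit n r k).hs at ha
  rw [kit_hs, List.mem_map] at ha
  obtain ⟨h1, h2, h3⟩ := @sizes n r k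
  obtain ⟨j, hj, rfl⟩ := ha
  rw [List.mem_range] at hj; rw [wire_val n r k (by omega)]; omega

/-- Value of the dummy wire. [folklore] -/
theorem d0_val : ((geom n r k).kit.d0 : ℕ) = dataOff n r := by
  change (((kit n r k).d0 : Fin _) : ℕ) = _
  rw [kit_d0, wire_val n r k (by obtain ⟨h1, h2, h3⟩ := @sizes n r k; omega)]

/-- **The geometry of a copy is well formed** (`k ≥ 1`). [folklore] -/
theorem geom_ok (hk : 1 ≤ k) : (geom n r k).OK := by
  obtain ⟨h1, h2, h3⟩ := @sizes n r k
  have hrb : (geom n r k).kit.rb = rb n r k := rfl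
  refine
    { kit := kit_ok n r k hk
      letter := fun s p => ?_
      E_lt := fun x => by rw [hrb, E_val]; have := x.2; omega
      E_had := fun x h => by have := had_val h; rw [E_val] at this; have := x.2; omega
      E_hs := fun x h => by have := hs_val h; rw [E_val] at this; have := x.2; omega
      q_E := by rintro ⟨x, hx⟩; have := congrArg Fin.val hx; rw [E_val, q_val] at this; omega
      tw_E := fun s p => by rintro ⟨x, hx⟩; have := congrArg Fin.val hx; rw [E_val, tw_val, twNat] at this; have := x.2; omega
      q_lt := by rw [hrb, q_val]; omega
      q_had := fun h => by have := had_val h; rw [q_val] at this; omega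
      q_hs := fun h => by have := hs_val h; rw [q_val] at this; omega
      q_tw := fun s p h => by have := congrArg Fin.val h; rw [q_val, tw_val, twNat] at this; omega }
  have htw := twNat_lt s.2 p (n := n)
  exact
    { e_lt := fun j => by rw [hrb]; have := eOf_val_lt (n := n) (r := r) (k := k) p.1 j; omega
      q_lt := by rw [hrb, q_val]; omega
      w_lt := by rw [hrb, tw_val]; omega
      e_had := fun j h => by have := had_val h; have := eOf_val_lt (n := n) (r := r) (k := k) p.1 j; omega
      q_had := fun h => by have := had_val h; rw [q_val] at this; omega
      w_had := fun h => by have := had_val h; rw [tw_val] at this; omega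
      e_hs := fun j h => by have := hs_val h; have := eOf_val_lt (n := n) (r := r) (k := k) p.1 j; omega
      q_hs := fun h => by have := hs_val h; rw [q_val] at this; omega
      w_hs := fun h => by have := hs_val h; rw [tw_val] at this; omega
      q_e := by rintro ⟨j, hj⟩; have := congrArg Fin.val hj; rw [eOf_val, q_val] at this; omega
      w_e := by rintro ⟨j, hj⟩; have := congrArg Fin.val hj; rw [eOf_val, tw_val, twNat] at this; have := j.2; omega
      qw := fun h => by have := congrArg Fin.val h; rw [q_val, tw_val, twNat] at this; omega
      d0_e := by rintro ⟨j, hj⟩; have := congrArg Fin.val hj; rw [eOf_val, d0_val, h1] at this; have := j.2; have := p.1.2; omega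
      d0_q := fun h => by have := congrArg Fin.val h; rw [d0_val, q_val] at this; omega
      d0_w := fun h => by have := congrArg Fin.val h; rw [d0_val, tw_val] at this; omega }

end BlockGeom

end Literature.Computability.QuantumComplexity
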